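import Literature.AlgebraicGeometry.ModuliOfAbelianVarieties.SiegelPrincipalLevelMultiplier
import Literature.AlgebraicGeometry.ModuliOfAbelianVarieties.SiegelShimuraSet
import Literature.NumberTheory.Adeles.RatFiniteIdeleCongruenceClasses
import HarnessLib

/-!
# Two principal representatives of the same residue differ by `K_δ(N)`

Topic `AlgebraicGeometry/ModuliOfAbelianVarieties`; namespace `Literature.AlgebraicGeometry.ModuliOfAbelianVarieties`.
KERNEL ONLY: theorems; no definition, no named fact, no instance, no `sorry`.  Cell `hodgecm-mathlib`, (U)-HEAD glue
leaf L2 (census `typers/CENSUS-Uglue.B-p21g13.md` §2 L2, B-plan2 (g10) road (R1) 2026-08-29).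

Milne's representatives for the pieces of `Sh_{K_δ(N)}(GSp_δ, S^±)(ℂ)` ([Milne2005ShimuraVarieties] §5 (5.2), Lemma 5.13 p. 57;
[Deligne1971TravauxShimura] Exemple 4.16 p. 150) are the integral diagonal similitudes `r = diag(1_g, u·1_g) ∈ K_δ(1)` with
`u ∈ ẑ^×`, `u ≡ c (mod N·ẑ)` for a residue `c ∈ (ℤ/N)^×` (★ R60-27 `exists_principalRep`).  The representative of a residue is
NOT unique; this file records that the ambiguity is absorbed by the level group:

* §1 `sub_one_mem_levelIdeal_of_sub_mem` — for `ẑ`-units `u, u′` with `u′ - u ∈ N·ẑ`: `u⁻¹u′ - 1 ∈ N·ẑ` (and symmetrically);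
* §2 **`inv_mul_mem_principalLevelSubgroup_of_matrix_eq`** — if `r, r′ ∈ GSp_δ(𝔸_f)` have matrices `diag(1, u·1)`,
  `diag(1, u′·1)` with `u, u′ ∈ ẑ^×`, `u′ ≡ u (mod N)`, then `r⁻¹ r′ ∈ K_δ(N)` (it IS the section `diag(1, u⁻¹u′·1)` of ★ R60-4
  `exists_mem_principalLevelSubgroup_isMultiplier`); the (U3)-binder form `inv_mul_mem_principalLevelSubgroup_of_principalRep`
  (both `u, u′ ≡ c.val (mod N)`);
* §3 `SiegelShimuraSet.mk_eq_mk_of_principalRep` — hence `[J, r K_δ(N)] = [J, r′ K_δ(N)]` for every `J ∈ S^±`: the class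
  attached to a residue does not depend on the chosen representative (the input of the marking transport (T) when the glue
  of the complex uniformisation changes representative).

## References
* [Milne2005ShimuraVarieties] J. S. Milne, *Introduction to Shimura varieties* (2005), §5 (5.2), Lemma 5.13 p. 57; §6 p. 70.
* [Deligne1971TravauxShimura] P. Deligne, *Travaux de Shimura*, Sém. Bourbaki 389 (1971), Exemple 4.16 p. 150.
-/

set_option autoImplicit false

open Matrix NumberField IsDedekindDomain

namespace Literature.AlgebraicGeometry.ModuliOfAbelianVarieties

variable {g : ℕ} {δ : Fin g → ℕ} {N : ℕ}

/-! ### §1. Quotients of congruent `ẑ`-units -/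

/-- For `ẑ`-units `u, u′` (all local absolute values `1`) with `u′ - u ∈ N·ẑ`: `u⁻¹u′ - 1 ∈ N·ẑ`
(`u⁻¹u′ - 1 = u⁻¹(u′ - u)` and `u⁻¹ ∈ ẑ`). [cite: Deligne1971TravauxShimura, Exemple 4.16 p. 150] -/
theorem sub_one_mem_levelIdeal_of_sub_mem {u u' : finAdeleQˣ}
    (hu : ∀ v : HeightOneSpectrum (𝓞 ℚ), Valued.v ((u : finAdeleQ) v) = 1)
    (h : (u' : finAdeleQ) - u ∈ levelIdeal N) :
    ((u⁻¹ * u' : finAdeleQˣ) : finAdeleQ) - 1 ∈ levelIdeal N := by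
  obtain ⟨-, hui⟩ := (Literature.NumberTheory.Adeles.forall_valued_eq_one_iff_mem_integralAdeles u).1 hu
  have he : ((u⁻¹ * u' : finAdeleQˣ) : finAdeleQ) - 1 = ((u⁻¹ : finAdeleQˣ) : finAdeleQ) * ((u' : finAdeleQ) - u) := by
    rw [Units.val_mul, mul_sub, Units.inv_mul]
  rw [he]
  exact mul_mem_levelIdeal_of_mem_integralAdeles hui h

/-- Symmetric form: `u′⁻¹u - 1 ∈ N·ẑ` as well (it is the inverse unit). [cite: Deligne1971TravauxShimura, Exemple 4.16 p. 150] -/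
theorem inv_sub_one_mem_levelIdeal_of_sub_mem {u u' : finAdeleQˣ}
    (hu' : ∀ v : HeightOneSpectrum (𝓞 ℚ), Valued.v ((u' : finAdeleQ) v) = 1)
    (h : (u' : finAdeleQ) - u ∈ levelIdeal N) :
    (((u⁻¹ * u')⁻¹ : finAdeleQˣ) : finAdeleQ) - 1 ∈ levelIdeal N := by
  rw [_root_.mul_inv_rev, inv_inv]
  refine sub_one_mem_levelIdeal_of_sub_mem hu' ?_
  have he : (u : finAdeleQ) - u' = -((u' : finAdeleQ) - u) := by ring
  rw [he]
  exact neg_mem h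

/-- Two `ẑ`-units congruent to the same residue `c.val (mod N)` are congruent to each other.
[cite: Milne2005ShimuraVarieties, §5 (5.2) and Lemma 5.13 p. 57] -/
theorem sub_mem_levelIdeal_of_sub_natCast_mem {u u' : finAdeleQ} {a : ℕ}
    (huc : u - (a : finAdeleQ) ∈ levelIdeal N) (hu'c : u' - (a : finAdeleQ) ∈ levelIdeal N) :
    u' - u ∈ levelIdeal N := by
  have he : u' - u = (u' - (a : finAdeleQ)) - (u - (a : finAdeleQ)) := by ring
  rw [he]
  exact sub_mem hu'c huc

/-! ### §2. `r⁻¹ r′ ∈ K_δ(N)` -/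

/-- **Two integral diagonal similitudes with congruent units differ by `K_δ(N)`**: if `r, r′ ∈ GSp_δ(𝔸_{ℚ,f})` have
matrices `diag(1_g, u·1_g)` and `diag(1_g, u′·1_g)` with `u, u′ ∈ ẑ^×` and `u′ ≡ u (mod N·ẑ)`, then `r⁻¹r′ ∈ K_δ(N)` —
indeed `r · d(u⁻¹u′) = r′` for the section `d(w) = diag(1_g, w·1_g) ∈ K_δ(N)` of ★ `exists_mem_principalLevelSubgroup_isMultiplier`.
[cite: Milne2005ShimuraVarieties, §5 (5.2), Lemma 5.13 p. 57; §6 p. 70] [cite: Deligne1971TravauxShimura, Exemple 4.16 p. 150] -/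
theorem inv_mul_mem_principalLevelSubgroup_of_matrix_eq {u u' : finAdeleQˣ} {r r' : gspFinAdelic δ}
    (hu : ∀ v : HeightOneSpectrum (𝓞 ℚ), Valued.v ((u : finAdeleQ) v) = 1)
    (hu' : ∀ v : HeightOneSpectrum (𝓞 ℚ), Valued.v ((u' : finAdeleQ) v) = 1)
    (h : (u' : finAdeleQ) - u ∈ levelIdeal N)
    (hr : ((r : GL (Fin g ⊕ Fin g) finAdeleQ) : Matrix (Fin g ⊕ Fin g) (Fin g ⊕ Fin g) finAdeleQ) =
      Matrix.fromBlocks 1 0 0 ((u : finAdeleQ) • (1 : Matrix (Fin g) (Fin g) finAdeleQ)))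
    (hr' : ((r' : GL (Fin g ⊕ Fin g) finAdeleQ) : Matrix (Fin g ⊕ Fin g) (Fin g ⊕ Fin g) finAdeleQ) =
      Matrix.fromBlocks 1 0 0 ((u' : finAdeleQ) • (1 : Matrix (Fin g) (Fin g) finAdeleQ))) :
    r⁻¹ * r' ∈ principalLevelSubgroup δ N := by
  obtain ⟨γ, hγ, -, hγmat⟩ := exists_mem_principalLevelSubgroup_isMultiplier δ (u⁻¹ * u')
    (sub_one_mem_levelIdeal_of_sub_mem hu h) (inv_sub_one_mem_levelIdeal_of_sub_mem hu' h)
  -- `r γ = r′` as adelic matrices, hence in `GSp_δ(𝔸_f)`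
  have hw : ((u⁻¹ * u' : finAdeleQˣ) : finAdeleQ) * (u : finAdeleQ) = (u' : finAdeleQ) := by
    rw [Units.val_mul, mul_right_comm, Units.inv_mul, one_mul]
  have hmat : ((r * γ : gspFinAdelic δ) : GL (Fin g ⊕ Fin g) finAdeleQ) = (r' : GL (Fin g ⊕ Fin g) finAdeleQ) := by
    refine Units.ext ?_
    rw [Subgroup.coe_mul, Units.val_mul, hr, hγmat, hr', Matrix.fromBlocks_multiply]
    simp only [Matrix.mul_zero, add_zero, zero_add, Matrix.mul_one, Matrix.mul_smul, smul_smul, smul_zero, hw]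
  have hrγ : r * γ = r' := Subtype.ext hmat
  rw [← hrγ, ← mul_assoc, inv_mul_cancel, one_mul]
  exact hγ

/-- **(U3)-binder form — two principal representatives of the SAME residue differ by `K_δ(N)`**: for `c ∈ (ℤ/N)^×` and
`r = diag(1, u·1)`, `r′ = diag(1, u′·1)` with `u, u′ ∈ ẑ^×`, `u ≡ c.val ≡ u′ (mod N·ẑ)` (the four binders of ★ (U) (U3) /
★ `exists_principalRep`, of which only the unit, residue and matrix clauses are used): `r⁻¹r′ ∈ K_δ(N)`.
[cite: Milne2005ShimuraVarieties, §5 (5.2), Lemma 5.13 p. 57] [cite: Deligne1971TravauxShimura, Exemple 4.16 p. 150] -/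
theorem inv_mul_mem_principalLevelSubgroup_of_principalRep {c : (ZMod N)ˣ} {u u' : finAdeleQˣ} {r r' : gspFinAdelic δ}
    (hu : ∀ v : HeightOneSpectrum (𝓞 ℚ), Valued.v ((u : finAdeleQ) v) = 1)
    (huc : (u : finAdeleQ) - ((c : ZMod N).val : ℕ) ∈ levelIdeal N)
    (hr : ((r : GL (Fin g ⊕ Fin g) finAdeleQ) : Matrix (Fin g ⊕ Fin g) (Fin g ⊕ Fin g) finAdeleQ) =
      Matrix.fromBlocks 1 0 0 ((u : finAdeleQ) • (1 : Matrix (Fin g) (Fin g) finAdeleQ)))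
    (hu' : ∀ v : HeightOneSpectrum (𝓞 ℚ), Valued.v ((u' : finAdeleQ) v) = 1)
    (hu'c : (u' : finAdeleQ) - ((c : ZMod N).val : ℕ) ∈ levelIdeal N)
    (hr' : ((r' : GL (Fin g ⊕ Fin g) finAdeleQ) : Matrix (Fin g ⊕ Fin g) (Fin g ⊕ Fin g) finAdeleQ) =
      Matrix.fromBlocks 1 0 0 ((u' : finAdeleQ) • (1 : Matrix (Fin g) (Fin g) finAdeleQ))) :
    r⁻¹ * r' ∈ principalLevelSubgroup δ N :=
  inv_mul_mem_principalLevelSubgroup_of_matrix_eq hu hu' (sub_mem_levelIdeal_of_sub_natCast_mem huc hu'c) hr hr'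

/-! ### §3. The class `[J, r K_δ(N)]` does not depend on the representative -/

/-- `[J, aK] = [J, a′K]` whenever `a⁻¹a′ ∈ K` (same complex structure; `aK = a′K`).
[cite: Milne2005ShimuraVarieties, §5 p. 57] -/
theorem SiegelShimuraSet.mk_eq_mk_of_inv_mul_mem (K : Subgroup (gspFinAdelic δ)) (J : C0pm δ) {a a' : gspFinAdelic δ}
    (h : a⁻¹ * a' ∈ K) : SiegelShimuraSet.mk δ K J a = SiegelShimuraSet.mk δ K J a' := by
  unfold SiegelShimuraSet.mk
  rw [QuotientGroup.eq.2 h]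

/-- **The class of a residue**: for two principal representatives `r, r′` of the same residue `c ∈ (ℤ/N)^×` and every
`J ∈ S^±`, `[J, r K_δ(N)] = [J, r′ K_δ(N)]` in `Sh_{K_δ(N)}(GSp_δ, S^±)(ℂ)`. [cite: Milne2005ShimuraVarieties, §5 (5.2), Lemma 5.13 p. 57]
[cite: Deligne1971TravauxShimura, Exemple 4.16 p. 150] -/
theorem SiegelShimuraSet.mk_eq_mk_of_principalRep {c : (ZMod N)ˣ} {u u' : finAdeleQˣ} {r r' : gspFinAdelic δ}
    (hu : ∀ v : HeightOneSpectrum (𝓞 ℚ), Valued.v ((u : finAdeleQ) v) = 1)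
    (huc : (u : finAdeleQ) - ((c : ZMod N).val : ℕ) ∈ levelIdeal N)
    (hr : ((r : GL (Fin g ⊕ Fin g) finAdeleQ) : Matrix (Fin g ⊕ Fin g) (Fin g ⊕ Fin g) finAdeleQ) =
      Matrix.fromBlocks 1 0 0 ((u : finAdeleQ) • (1 : Matrix (Fin g) (Fin g) finAdeleQ)))
    (hu' : ∀ v : HeightOneSpectrum (𝓞 ℚ), Valued.v ((u' : finAdeleQ) v) = 1)
    (hu'c : (u' : finAdeleQ) - ((c : ZMod N).val : ℕ) ∈ levelIdeal N)
    (hr' : ((r' : GL (Fin g ⊕ Fin g) finAdeleQ) : Matrix (Fin g ⊕ Fin g) (Fin g ⊕ Fin g) finAdeleQ) =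
      Matrix.fromBlocks 1 0 0 ((u' : finAdeleQ) • (1 : Matrix (Fin g) (Fin g) finAdeleQ))) (J : C0pm δ) :
    SiegelShimuraSet.mk δ (principalLevelSubgroup δ N) J r = SiegelShimuraSet.mk δ (principalLevelSubgroup δ N) J r' :=
  SiegelShimuraSet.mk_eq_mk_of_inv_mul_mem (principalLevelSubgroup δ N) J
    (inv_mul_mem_principalLevelSubgroup_of_principalRep hu huc hr hu' hu'c hr')

end Literature.AlgebraicGeometry.ModuliOfAbelianVarieties
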